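import Literature.Analysis.FluidPDE.CollisionalTransfer
import Literature.Analysis.FluidPDE.HardSphereCollisionRecord
import Literature.MathematicalPhysics.KineticTheory.HardSphereCanonicalTorus
import HarnessLib

/-!
# Velocity variation and weighted displacements along a hard-sphere orbit

Topic `Literature/MathematicalPhysics/KineticTheory` — two pathwise a-priori bounds along ONE hard-sphere
trajectory `γ` (`IsHardSphereTrajectory`, Gallagher–Saint-Raymond–Texier 2013 Def. 4.1.2), the bookkeeping
input of window / Riemann-sum reductions of time integrals of configurational functionals (Cercignani–
Illner–Pulvirenti 1994 App. 4.A: collisions in short time windows):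

* `IsHardSphereTrajectory.sum_norm_vel_sub_leftLim_le` — at a collision of the pair `{i, j}` the `ℓ¹` size
  of the velocity jump of the whole configuration is `≤ 2 + ‖vᵢ⁺‖² + ‖vⱼ⁺‖²` (only the pair jumps,
  `‖Δvᵢ‖ ≤ ‖vᵢ⁺‖ + ‖vᵢ⁻‖`, `x ≤ (1 + x²)/2`, conservation of the pair energy).
* `IsHardSphereTrajectory.sum_norm_vel_sub_vel_le` — **velocity variation**: for `a ≤ b`,
  `Σₖ ‖vₖ(b) − vₖ(a)‖ ≤ 2 · Σ_{collision times t ∈ (a, b]} Σ_{ordered contact pairs (i,j) at t} (1 + ‖vᵢ(t)‖² + ‖vⱼ(t)‖²)`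
  (`collisionPairSum` of `HardSphereCollisionRecord`; velocities read at the collision instant, the weight
  being collision-invariant).  Proof: the weak balance law `sub_eq_integral_add_collisionalTransfer` of
  `CollisionalTransfer` for the observable `z ↦ (vₖ)ₖ` (streaming derivative `0`) writes `v(b) − v(a)` as
  the finite sum of its jumps; then the triangle inequality and the one-collision bound (the colliding
  ordered pair `(i, j)` is one of the contact pairs and the weight is nonnegative — no regularity of the
  geometry is needed, at the price of the factor `2`).  Torus instance `…_torus`.
* `IsHardSphereTrajectory.weightedDisp_le_of_le` — **weighted displacement** on `𝕋³`: for `s ≤ s'` and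
  weights `cᵢ ≥ 0`, `Σᵢ cᵢ d(xᵢ(s'), xᵢ(s)) ≤ √(Σᵢ cᵢ²) · √(2E) · (s' − s)` (`E` the conserved kinetic energy,
  `d` the minimal-image distance): fencing lemma on the continuous function of time
  `u ↦ Σᵢ cᵢ d(xᵢ(u), xᵢ(s))`, whose right slopes are `≤ Σᵢ cᵢ ‖vᵢ(u)‖ ≤ √(Σcᵢ²)√(2E)` by free flight to the
  right of every time and Cauchy–Schwarz (same scheme as the mean-displacement bound of route
  JParityClosure, which is the case `cᵢ = 1`).

## References

* I. Gallagher, L. Saint-Raymond, B. Texier, *From Newton to Boltzmann* (2013), §1.1, §4.1.  [GST2013]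
* C. Cercignani, R. Illner, M. Pulvirenti, *The Mathematical Theory of Dilute Gases* (1994), §4.2,
  App. 4.A.  [CIPDiluteGases1994]
* R. Soto, *Kinetic Theory and Transport Phenomena* (2016), §4.8.1 (collisional transfer).  [Soto2016]

## Not here

No probability: these are deterministic statements about one orbit; their use under a law of the initial
data is problem-side.
-/

noncomputable section

open Set Filter Topology Function MeasureTheory
open scoped BigOperators InnerProductSpace

namespace Literature.MathematicalPhysics.KineticTheory

open Literature.Analysis.FluidPDE

/-! ## The velocity jump at one collision -/

section Velocity

variable {d : Type*} [Fintype d] {X : Type*} [TopologicalSpace X] [T2Space X] {N : ℕ}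
  {G : Geometry d X} {ε : ℝ} {γ : ℝ → Config N d X}

/-- **The `ℓ¹` size of the velocity jump at a binary collision.**  At a collision time of the pair
`{i, j}` of a hard-sphere trajectory (Hausdorff position space), only `vᵢ, vⱼ` jump and
`Σₖ ‖vₖ(t) − vₖ(t⁻)‖ ≤ 2 + ‖vᵢ(t)‖² + ‖vⱼ(t)‖²` (`‖Δv‖ ≤ ‖v⁺‖ + ‖v⁻‖`, `x ≤ (1+x²)/2` and
`‖vᵢ⁺‖² + ‖vⱼ⁺‖² = ‖vᵢ⁻‖² + ‖vⱼ⁻‖²`). [folklore] -/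
theorem _root_.Literature.Analysis.FluidPDE.IsHardSphereTrajectory.sum_norm_vel_sub_leftLim_le
    (h : IsHardSphereTrajectory G ε N γ) {t : ℝ} {i j : Fin N} (hij : i ≠ j)
    (hc : γ t ∈ contactSet G N ε i j) :
    ∑ k, ‖(γ t k).2 - (Function.leftLim γ t k).2‖ ≤ 2 + ‖(γ t i).2‖ ^ 2 + ‖(γ t j).2‖ ^ 2 := by
  rw [Fintype.sum_eq_add i j hij fun k hk => by
    rw [h.apply_eq_leftLim_apply_of_ne hij hc hk.1 hk.2, sub_self, norm_zero]]
  have hE := h.norm_sq_vel_add_eq_leftLim hij hc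
  have h1 := norm_sub_le (γ t i).2 (Function.leftLim γ t i).2
  have h2 := norm_sub_le (γ t j).2 (Function.leftLim γ t j).2
  nlinarith [sq_nonneg (‖(γ t i).2‖ - 1), sq_nonneg (‖(Function.leftLim γ t i).2‖ - 1),
    sq_nonneg (‖(γ t j).2‖ - 1), sq_nonneg (‖(Function.leftLim γ t j).2‖ - 1)]

/-! ## The velocity variation over a window -/

/-- **Velocity variation along a hard-sphere trajectory.**  For `a ≤ b` (Hausdorff position space,
continuous translations):
`Σₖ ‖vₖ(b) − vₖ(a)‖ ≤ 2 · collisionPairSum G ε γ (a, b] (t, i, j ↦ 1 + ‖vᵢ(t)‖² + ‖vⱼ(t)‖²)`.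
The weak balance law for the velocity observable (streaming derivative `0`) writes `v(b) − v(a)` as the
sum of its jumps at the collision times in `(a, b]`; each jump is bounded by
`sum_norm_vel_sub_leftLim_le`, and the colliding ordered pair is one of the (nonnegatively weighted)
contact pairs at that time. [folklore] -/
theorem _root_.Literature.Analysis.FluidPDE.IsHardSphereTrajectory.sum_norm_vel_sub_vel_le
    (h : IsHardSphereTrajectory G ε N γ) (hG : ∀ x : X, Continuous (G.translate x)) {a b : ℝ}
    (hab : a ≤ b) :
    ∑ k, ‖(γ b k).2 - (γ a k).2‖ ≤
      2 * collisionPairSum G ε γ (Ioc a b) (fun t i j => 1 + ‖(γ t i).2‖ ^ 2 + ‖(γ t j).2‖ ^ 2) := by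
  classical
  set F : Config N d X → (Fin N → EuclideanSpace ℝ d) := fun z k => (z k).2 with hF
  have hFd : ∀ (z : Config N d X) (t : ℝ), HasDerivAt (fun s => F (freeFlight G s z))
      ((fun _ => (0 : Fin N → EuclideanSpace ℝ d)) (freeFlight G t z)) t := by
    intro z t
    have hconst : (fun s => F (freeFlight G s z)) = fun _ => F z := by
      funext s
      funext k
      simp [hF]
    rw [hconst]
    exact hasDerivAt_const t (F z)
  have hF' : ∀ z : Config N d X,
      Continuous fun t : ℝ => (fun _ => (0 : Fin N → EuclideanSpace ℝ d)) (freeFlight G t z) :=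
    fun z => continuous_const
  obtain ⟨-, heq⟩ := h.sub_eq_integral_add_collisionalTransfer (F := F)
    (F' := fun _ => (0 : Fin N → EuclideanSpace ℝ d)) hG hFd hF' hab
  have hfin := h.finite_collisionTimes_inter_Ioc a b
  rw [intervalIntegral.integral_zero, zero_add, collisionalTransfer_eq_sum F hfin] at heq
  have hcomp : ∀ k, (γ b k).2 - (γ a k).2 = ∑ t ∈ hfin.toFinset, collisionJump F γ t k := by
    intro k
    have hk := congrFun heq k
    simpa only [hF, Pi.sub_apply, Finset.sum_apply] using hk
  have hstep : ∀ t ∈ hfin.toFinset, ∑ k, ‖collisionJump F γ t k‖ ≤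
      2 * ∑ p ∈ contactPairs G ε (γ t), (1 + ‖(γ t p.1).2‖ ^ 2 + ‖(γ t p.2).2‖ ^ 2) := by
    intro t ht
    obtain ⟨i, j, hij, hc⟩ := ((Set.Finite.mem_toFinset hfin).1 ht).1
    have hjump : ∑ k, ‖collisionJump F γ t k‖ ≤ 2 + ‖(γ t i).2‖ ^ 2 + ‖(γ t j).2‖ ^ 2 := by
      have hj := h.sum_norm_vel_sub_leftLim_le hij hc
      simpa only [collisionJump, hF, Pi.sub_apply] using hj
    have hmem : (i, j) ∈ contactPairs G ε (γ t) := mem_contactPairs.2 ⟨hij, hc⟩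
    have hnn : ∀ p ∈ contactPairs G ε (γ t), (0 : ℝ) ≤ 1 + ‖(γ t p.1).2‖ ^ 2 + ‖(γ t p.2).2‖ ^ 2 :=
      fun p _ => by positivity
    have hsingle := Finset.single_le_sum hnn hmem
    dsimp only at hsingle
    linarith [sq_nonneg ‖(γ t i).2‖, sq_nonneg ‖(γ t j).2‖]
  calc ∑ k, ‖(γ b k).2 - (γ a k).2‖
      = ∑ k, ‖∑ t ∈ hfin.toFinset, collisionJump F γ t k‖ := by simp only [hcomp]
    _ ≤ ∑ k, ∑ t ∈ hfin.toFinset, ‖collisionJump F γ t k‖ :=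
        Finset.sum_le_sum fun k _ => norm_sum_le _ _
    _ = ∑ t ∈ hfin.toFinset, ∑ k, ‖collisionJump F γ t k‖ := Finset.sum_comm
    _ ≤ ∑ t ∈ hfin.toFinset,
          2 * ∑ p ∈ contactPairs G ε (γ t), (1 + ‖(γ t p.1).2‖ ^ 2 + ‖(γ t p.2).2‖ ^ 2) :=
        Finset.sum_le_sum hstep
    _ = 2 * collisionPairSum G ε γ (Ioc a b)
          (fun t i j => 1 + ‖(γ t i).2‖ ^ 2 + ‖(γ t j).2‖ ^ 2) := by
        rw [collisionPairSum_eq_finset_sum hfin, Finset.mul_sum]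

end Velocity

/-- **Velocity variation on the flat torus** (`sum_norm_vel_sub_vel_le` with the continuity of the torus
translations discharged). [folklore] -/
theorem _root_.Literature.Analysis.FluidPDE.IsHardSphereTrajectory.sum_norm_vel_sub_vel_le_torus
    {d : Type*} [Fintype d] {N : ℕ} {ε : ℝ} {γ : ℝ → Config N d (UnitAddTorus d)}
    (h : IsHardSphereTrajectory (Torus.geometry d) ε N γ) {a b : ℝ} (hab : a ≤ b) :
    ∑ k, ‖(γ b k).2 - (γ a k).2‖ ≤
      2 * collisionPairSum (Torus.geometry d) ε γ (Ioc a b)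
        (fun t i j => 1 + ‖(γ t i).2‖ ^ 2 + ‖(γ t j).2‖ ^ 2) :=
  h.sum_norm_vel_sub_vel_le
    (fun _ => continuous_const.add Literature.Analysis.FunctionSpaces.Torus.continuous_proj) hab

/-! ## Weighted displacements on `𝕋³` -/

section Displacement

/-- Cauchy–Schwarz for weighted speeds: `Σᵢ cᵢ ‖vᵢ‖ ≤ √(Σᵢ cᵢ²) · √(2 E(w))`, `E = ½ Σᵢ ‖vᵢ‖²`.
[folklore] -/
theorem sum_mul_norm_vel_le_sqrt {n : ℕ} {X : Type*} (c : Fin n → ℝ) (w : Config n (Fin 3) X) :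
    ∑ i, c i * ‖(w i).2‖ ≤ Real.sqrt (∑ i, c i ^ 2) * Real.sqrt (2 * configEnergy w) := by
  have h2 : 2 * configEnergy w = ∑ i, ‖(w i).2‖ ^ 2 := by
    simp only [configEnergy]
    ring
  rw [h2]
  exact Real.sum_mul_le_sqrt_mul_sqrt _ _ _

/-- Weighted displacement under free flight: `Σᵢ cᵢ d(xᵢ + t vᵢ, xᵢ) ≤ |t| · √(Σcᵢ²) · √(2E)` for
`cᵢ ≥ 0` (each particle moves by at most `|t| ‖vᵢ‖` in the minimal-image distance,
`Torus.euclidDist_translate_le`; then Cauchy–Schwarz). [folklore] -/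
theorem weightedDisp_freeFlight_le {n : ℕ} (w : Config n (Fin 3) T3) (t : ℝ) {c : Fin n → ℝ}
    (hc : ∀ i, 0 ≤ c i) :
    ∑ i, c i * Torus.euclidDist ((freeFlight (Torus.geometry (Fin 3)) t w i).1) ((w i).1) ≤
      |t| * (Real.sqrt (∑ i, c i ^ 2) * Real.sqrt (2 * configEnergy w)) := by
  -- per-particle bound, adapted from `Theorems.meanDisp_euclidDist_freeFlight_le` (JParityClosure)
  have hone : ∀ i, Torus.euclidDist ((freeFlight (Torus.geometry (Fin 3)) t w i).1) ((w i).1) ≤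
      |t| * ‖(w i).2‖ := by
    intro i
    have h := Torus.euclidDist_translate_le (w i).1 (w i).1 (t • (w i).2) 0
    rw [Literature.Analysis.FunctionSpaces.Torus.proj_zero, add_zero, Torus.euclidDist_self, zero_add,
      sub_zero, norm_smul, Real.norm_eq_abs] at h
    simpa only [freeFlight_apply, Torus.geometry_translate] using h
  calc ∑ i, c i * Torus.euclidDist ((freeFlight (Torus.geometry (Fin 3)) t w i).1) ((w i).1)
      ≤ ∑ i, c i * (|t| * ‖(w i).2‖) :=
        Finset.sum_le_sum fun i _ => mul_le_mul_of_nonneg_left (hone i) (hc i)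
    _ = |t| * ∑ i, c i * ‖(w i).2‖ := by
        rw [Finset.mul_sum]
        exact Finset.sum_congr rfl fun i _ => by ring
    _ ≤ |t| * (Real.sqrt (∑ i, c i ^ 2) * Real.sqrt (2 * configEnergy w)) :=
        mul_le_mul_of_nonneg_left (sum_mul_norm_vel_le_sqrt c w) (abs_nonneg t)

/-- **Weighted displacement bound along a hard-sphere trajectory on `𝕋³`.**  For `s ≤ s'` and
nonnegative weights `cᵢ`: `Σᵢ cᵢ d(xᵢ(s'), xᵢ(s)) ≤ √(Σᵢ cᵢ²) · √(2 E(γ s)) · (s' − s)` — fencing lemma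
`image_le_of_liminf_slope_right_le_deriv_boundary` for `u ↦ Σᵢ cᵢ d(xᵢ(u), xᵢ(s))` (continuous: positions
are continuous) against the affine barrier of slope `√(Σcᵢ²)√(2E)`: to the right of every time the orbit
is free flight on a collision-free interval (`exists_Ioo_right_free`, `eq_freeFlight_of_Ioo_free`), so
right slopes are bounded by `weightedDisp_freeFlight_le` and conservation of the kinetic energy
(`configEnergy_eq_holds`).  The case `cᵢ = 1` is the mean-displacement bound. [folklore] -/
theorem _root_.Literature.Analysis.FluidPDE.IsHardSphereTrajectory.weightedDisp_le_of_le {ε : ℝ} {n : ℕ}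
    {γ : ℝ → Config n (Fin 3) T3} (hγ : IsHardSphereTrajectory (Torus.geometry (Fin 3)) ε n γ)
    {c : Fin n → ℝ} (hc : ∀ i, 0 ≤ c i) {s s' : ℝ} (hss' : s ≤ s') :
    ∑ i, c i * Torus.euclidDist ((γ s' i).1) ((γ s i).1) ≤
      Real.sqrt (∑ i, c i ^ 2) * Real.sqrt (2 * configEnergy (γ s)) * (s' - s) := by
  -- adapted from `Theorems.meanDisp_le_of_le` (route JParityClosure, DensityCap)
  set V := Real.sqrt (∑ i, c i ^ 2) * Real.sqrt (2 * configEnergy (γ s)) with hV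
  set f : ℝ → ℝ := fun τ => ∑ i, c i * Torus.euclidDist ((γ τ i).1) ((γ s i).1) with hf
  have hfc : Continuous f := by
    refine continuous_finsetSum _ fun i _ => continuous_const.mul ?_
    have h2 : Continuous fun τ => ((γ τ i).1, (γ s i).1) :=
      (hγ.pos_continuous i).prodMk continuous_const
    simpa only [Function.comp_def] using Torus.continuous_euclidDist.comp h2
  have hB : ∀ x, HasDerivWithinAt (fun τ => V * (τ - s)) V (Ici x) x := fun x => by
    simpa using ((hasDerivWithinAt_id x (Ici x)).sub_const s).const_mul V
  have key : ∀ x ∈ Ico s s', ∀ r, V < r → ∃ᶠ z in 𝓝[>] x, slope f x z < r := by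
    intro x _ r hr
    obtain ⟨u, hxu, hfree⟩ := hγ.exists_Ioo_right_free x
    have hE : configEnergy (γ x) = configEnergy (γ s) :=
      IsHardSphereTrajectory.configEnergy_eq_holds hγ x s
    refine Filter.Eventually.frequently ?_
    filter_upwards [Ioo_mem_nhdsGT hxu] with z hz
    have hzx : 0 < z - x := sub_pos.2 hz.1
    have hγz : γ z = freeFlight (Torus.geometry (Fin 3)) (z - x) (γ x) :=
      hγ.eq_freeFlight_of_Ioo_free hfree ⟨hz.1.le, hz.2⟩
    have hstep : f z - f x ≤ V * (z - x) := by
      have htri : ∀ i, c i * Torus.euclidDist ((γ z i).1) ((γ s i).1) -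
          c i * Torus.euclidDist ((γ x i).1) ((γ s i).1) ≤ c i * Torus.euclidDist ((γ z i).1) ((γ x i).1) := by
        intro i
        rw [← mul_sub]
        refine mul_le_mul_of_nonneg_left ?_ (hc i)
        linarith [euclidDist_triangle ((γ z i).1) ((γ x i).1) ((γ s i).1)]
      calc f z - f x = ∑ i, (c i * Torus.euclidDist ((γ z i).1) ((γ s i).1) -
            c i * Torus.euclidDist ((γ x i).1) ((γ s i).1)) := by
            simp only [hf, Finset.sum_sub_distrib]
        _ ≤ ∑ i, c i * Torus.euclidDist ((γ z i).1) ((γ x i).1) := Finset.sum_le_sum fun i _ => htri i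
        _ = ∑ i, c i * Torus.euclidDist
              ((freeFlight (Torus.geometry (Fin 3)) (z - x) (γ x) i).1) ((γ x i).1) := by rw [hγz]
        _ ≤ |z - x| * (Real.sqrt (∑ i, c i ^ 2) * Real.sqrt (2 * configEnergy (γ x))) :=
            weightedDisp_freeFlight_le _ _ hc
        _ = V * (z - x) := by rw [abs_of_pos hzx, hE, hV, mul_comm]
    rw [slope_def_field]
    calc (f z - f x) / (z - x) ≤ V := by rwa [div_le_iff₀ hzx]
      _ < r := hr
  have hfa : f s ≤ V * (s - s) := by simp [hf, Torus.euclidDist_self]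
  have hBc : Continuous fun τ => V * (τ - s) := by fun_prop
  exact image_le_of_liminf_slope_right_le_deriv_boundary (f := f) (B := fun τ => V * (τ - s))
    (B' := fun _ => V) hfc.continuousOn hfa hBc.continuousOn (fun x _ => hB x) key
    (right_mem_Icc.2 hss')

/-- **Mean displacement** (the case `cᵢ = 1`): for `s ≤ s'`,
`Σᵢ d(xᵢ(s'), xᵢ(s)) ≤ √n · √(2 E(γ s)) · (s' − s)`. [folklore] -/
theorem _root_.Literature.Analysis.FluidPDE.IsHardSphereTrajectory.sum_euclidDist_le_of_le {ε : ℝ} {n : ℕ}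
    {γ : ℝ → Config n (Fin 3) T3} (hγ : IsHardSphereTrajectory (Torus.geometry (Fin 3)) ε n γ)
    {s s' : ℝ} (hss' : s ≤ s') :
    ∑ i, Torus.euclidDist ((γ s' i).1) ((γ s i).1) ≤
      Real.sqrt n * Real.sqrt (2 * configEnergy (γ s)) * (s' - s) := by
  have h := hγ.weightedDisp_le_of_le (c := fun _ => (1 : ℝ)) (fun _ => zero_le_one) hss'
  simpa using h

/-- **Speed-weighted displacement** (the case `cᵢ = ‖vᵢ(s')‖`): for `s ≤ s'`,
`Σᵢ ‖vᵢ(s')‖ d(xᵢ(s'), xᵢ(s)) ≤ 2 E(γ s) (s' − s)` (the weights have `Σcᵢ² = 2E(γ s') = 2E(γ s)`).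
[folklore] -/
theorem _root_.Literature.Analysis.FluidPDE.IsHardSphereTrajectory.sum_norm_vel_mul_euclidDist_le_of_le
    {ε : ℝ} {n : ℕ} {γ : ℝ → Config n (Fin 3) T3}
    (hγ : IsHardSphereTrajectory (Torus.geometry (Fin 3)) ε n γ) {s s' : ℝ} (hss' : s ≤ s') :
    ∑ i, ‖(γ s' i).2‖ * Torus.euclidDist ((γ s' i).1) ((γ s i).1) ≤
      2 * configEnergy (γ s) * (s' - s) := by
  have h := hγ.weightedDisp_le_of_le (c := fun i => ‖(γ s' i).2‖) (fun _ => norm_nonneg _) hss'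
  have hE : ∑ i, ‖(γ s' i).2‖ ^ 2 = 2 * configEnergy (γ s) := by
    rw [← IsHardSphereTrajectory.configEnergy_eq_holds hγ s' s]
    simp only [configEnergy]
    ring
  have h0 : 0 ≤ 2 * configEnergy (γ s) := by
    unfold configEnergy
    positivity
  rw [hE, ← pow_two, Real.sq_sqrt h0] at h
  simpa only [pow_two] using h

end Displacement

end Literature.MathematicalPhysics.KineticTheory

end
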